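import Summits.QuantumFields.BalabanUV.Beta.FP.TorusCompositeCovarianceTwoPolar
import Summits.QuantumFields.BalabanUV.Beta.SymAveragingMixedJetTables

/-!
# `BalabanUV.Beta.FP.TorusStepInsertionSymTwo` — road «FP» for binder row D1, ROUTE T, (β1) RE-BASING (ROW RULING R-D1-g52-1 (3)(c) «→ leaf-02: sym twins of
# R-5∕R-6 `TorusStepInsertionPeriodic(Two)` (`stepIns₁Sym ∕ stepIns₂₂Sym` over `symVhSAt ∕ symVh₂SAt` bricks)»), PART 1 of the R-6 twin: **THE (0.4)-SYMMETRISED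
# ONE-STEP SECOND-ORDER INSERTION BI-JET `stepIns₂₂Sym w w′` AT THE CENTRED ROOT, AND THE ACTION OF ITS PER-PAIR MEMBER ON PERIODIC 1-FORMS AS an1's
# (0.4)-SYMMETRISED SECOND-ORDER KERNEL `symVh2KerAt`** — under reading (P) of Q-leaf02-g30-1 (the PLAIN sym second brick at generic `d`; the row's A-1 l.56422)

WHY.  R-D1-g52-1 re-bases the composite tower on an1's (0.4)-SYMMETRISED bricks at the centred root `ctr (d+1) Lc` at every level.  Order 1: R-18
`FP/TorusStepInsertionSym.stepIns₁Sym` (landed).  Order 2: the rooted one-step bi-jet `TorusCompositeCovarianceTwoPolar.stepIns₂₂ M Lc r w w′` reads an1's ROOTED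
packed table `vh₂SAt (toSite r) Lc`; this file types its sym twin over an1's PACKED (0.4)-SYMMETRISED table `symVh₂SAt (ctr (d+1) Lc) Lc` (`SymAveragingMixedJetTables`
(Q-C3) — the SAME packer `packVH` as `vh₂SAt`) and re-proves R-6 §1–§2 for it statement by statement; PART 2 (`FP/TorusStepInsertionSymTwoStep`) carries R-6 §3.

WHAT (generic `d`; box `M`, blocking `Lc`, `T = fine Lc M`; centred root, `hc : ctrOff (d+1) Lc ∈ box (d+1) Lc` displayed; `B` a `T`-periodic real 1-form).
* §1 [our object — bookkeeping] **`stepIns₂₂Sym M Lc w w′ := Σ_b Σ_{b′} (w b · w′ b′) • (perF T (dper T (V^{b′} b.2 b.1))).submatrix ((coarsePt, inr), (·, inl))`**, the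
  SECOND-BOND-PERIODISED PAIR-SYMMETRISED SYM MEMBER `V^{(κ′,u′)} κ u := Σ'_n ½ (symVh₂SAt (ctr (d+1) Lc) Lc κ u κ′ (u′ + T∘n) + symVh₂SAt (ctr (d+1) Lc) Lc κ′ (u′ + T∘n) κ u)`
  = `stepIns₂₂` CHARACTER FOR CHARACTER under `vh₂SAt (toSite r) ↦ symVh₂SAt (ctr (d+1) Lc)` (no root parameter: the sym brick is centred, as R-18's `stepIns₁Sym` and
  leaf-06's `QstepSym`); **`stepIns₂Sym M Lc w := stepIns₂₂Sym M Lc w w`** (the diagonal; twin of I-3 `stepIns₂`, `stepIns₂₂Sym_self` by `rfl`).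
* §2 one kernel-generic engine — a PRIVATE verbatim copy of R-6 §1 `sum_perZ_dper_mul_periodic_of_periodCov` (DISCLOSED: R-6's module p370506 ✓ has no hub olean at
  the time of writing — journal INFRA-1 l.56207 — so it cannot be imported by a file that is to verify now; de-duplicated by `import` once the lane serves).
* §3 entries ∕ support at the centred root: `symVh₂SAt_inr_inl_eq` (`packVH_inr_inl`), `symVh2KerAt_ctr_eq_zero_of_not_near` (an1's `symVh2Tab_eq_zero₁∕₂∕₃` read at
  `ctr (d+1) Lc = toSite (ctrOff (d+1) Lc)`, `rfl`), `symPair_inr_inl_eq_zero_of_not_mem` — twins of leaf-02 g25's `PeriodisedBorderWardContactTwo` letters.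
* §4 one pair of torus bonds: `symVh₂SAt_zsmul_inr_inl ∕ symPair_zsmul_inr_inl` (entries at a coarse multiplier site `Lc•x`), support ∕ summability of the
  pair-symmetrised sym kernel, the engine's three letters **`symBorderT2_periodCov`** (an1's `symVh₂SAt_translate` per copy through
  `PeriodisedBorderTables.apply_translate_of_blockCov₂`, re-indexing `n ↦ n + m`), **`symBorderT2_inr_inl_eq_zero_of_not_mem_T ∕ _S`** (twins of g25's `borderT2_*`), and
  **`sum_perF_dper_symPair_mul_periodic`**: `Σ_{y,l} perF T (dper T (V^{(κ′,u′)} κ u)) (coarsePt x, inr κ₀) (y, inl l) · B l y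
   = Σ'_m Σ'_n Σ'_z Σ_l ½ (symVh2KerAt (ctr (d+1) Lc) Lc κ₀ x (l,z) (κ, u+T∘m) (κ′, u′+T∘n) + symVh2KerAt (ctr (d+1) Lc) Lc κ₀ x (l,z) (κ′, u′+T∘n) (κ, u+T∘m)) · B l z`
  — R-6's `sum_perF_dper_pair_mul_periodic` VERBATIM under the substitution; every sum finite (all three bonds in `Near Lc x`).
NOT HERE: the weighted double sum `Σ_q stepIns₂₂Sym w w′ (x,κ₀) q · B q` (PART 2); the sym (COV-2) one-step LAW `stepIns₂Sym_mul_tgrad` (needs the order-2 contact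
supplier over the PLAIN sym brick at generic `d` — the tree's `PeriodisedSymBorderWardContactTwo.submatrix_borderT2per_mul_tgrad` is `d = 3` over an1's PACKAGED
`symVh₂SAn1 3 Lc`, g30 W-5 l.56372); `stepIns₂₂Sym_comm` ∕ bilinearity (with the sym pass of `compIns₂₂`); any chart; any estimate.

[our object — bookkeeping] two defs + [folklore] finite sums and finitely supported `tsum` re-indexing BY NAME over OUR bookkeeping objects (`perF ∕ perZ ∕ dper`,
`coarsePt ∕ wrapPt ∕ nearBox`, `apply_translate_of_blockCov₂`) and an1's typed tables (`symVh₂SAt = packVH symVh2KerAt`, `symVh2Tab_eq_zero₁∕₂∕₃`, `symVh₂SAt_translate`);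
no `def … : Prop`, nothing cited, 0 sorry, default heartbeats.  Nothing of the dictionary ∕ Bałaban's non-linear averages asserted beyond their typed linearisations
(that the re-based composite's second variation IS this chain of sym one-step tables is the ROW's (β1) ruling R-D1-g52-1 and an2's (C1) TABLE word, quoted, not
adjudicated here); NO chart fixed; the (C1) TABLES, the seven letters, `hH ∕ hQ` untouched.

HONEST DEPENDENCY (page 1, mandatory): continuum YM on T⁴ ⇐ BetaPertH ∧ nine spine estimates (0/9 proved); BetaPertH ⇐ (D1) ∧ (D4) ∧ CAP+tail;
G-an2-4 gates asym, D1 and NE2/3/4.  HONEST FRAMING (cell contract, verbatim): «discharging `BetaPertH` makes Bałaban's UV stability UNCONDITIONAL —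
a real constructive-QFT result; it is NOT the continuum limit and NOT the Clay problem.»  ABSOLUTE RULE (cell charter, verbatim): «No internally-minted
statement may enter as a cited fact. Every hypothesis is either kernel-proved in this package or a verbatim quotation of a PUBLISHED theorem with page
reference. The manuscript(s) under audit are NOT citable for their own disputed steps — they are the thing under adjudication; programme-internal
(2001/route/tribunal) claims are never citable.»  0 estimates; 0∕4 row-D1 binders (hW, hR, D1Tel, D1Rep); NOT (T-ID), NOT (C1), NOT SDF, NOT D1,
NOT BetaPertH, NOT continuum, NOT Clay.  D1 formalisation swarm LEAF PROVER 02 (b2b-balaban-beta-d1-formalise-leaf-02 gen 31 ∕ gen 32), 2026-08-24.  No existing file touched.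
-/

noncomputable section

open scoped BigOperators

namespace Summit.QuantumFields.BalabanUV.Beta.FP.TorusStepInsertionSymTwo

open Matrix Finset
open Literature.Probability.LatticeModels (Torus.proj)
open Literature.MathematicalPhysics.QuantumFieldTheory
open Literature.MathematicalPhysics.QuantumFieldTheory.Balaban1983to89
open Literature.MathematicalPhysics.QuantumFieldTheory.Balaban1983to89.Beta
open B5Prop11Plancherel (fine)
open B6Lemma24Torus (pbox mem_pbox wrap)
open B4TorusKernel.MultiPeriod (translate translate_apply translate_injective)
open B4Reflection242 (translate_translate)
open Summit.QuantumFields.BalabanUV.Beta.GAN24.DirichletExhaustionPeriodise (one_le_M)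
open ExpKernelCalculus (MKer shiftK)
open AffineAveraging (Site Form1 box toSite)
open AveragingContours (off blk)
open AveragingContoursRooted (ctr ctrOff ctrOff_mem_box)
open AveragingHessianKernels (Bond Near packVH_inr_inl)
open OneStepResolventKernel (Fib proj_zsmul quo_zsmul)
open LatticeForm (quo)
open Summit.QuantumFields.BalabanUV.Beta.BorderedHessian (off_eq_zero_iff_proj blk_eq_quo)
open Summit.QuantumFields.BalabanUV.Beta.SymAveragingMixedJetTables (symVh2Tab symVh2Tab_eq_zero₁ symVh2Tab_eq_zero₂ symVh2Tab_eq_zero₃ symVh2KerAt symVh₂SAt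
  symVh₂SAt_translate)
open Summit.QuantumFields.BalabanUV.Beta.GAN24.KernelPeriodisation (wrap_translate)
open Summit.QuantumFields.BalabanUV.Beta.FP.KernelPeriodisationFib (Idx perF perF_apply perZ perZ_apply)
open Summit.QuantumFields.BalabanUV.Beta.FP.KernelPeriodisationFibLoc (dper dper_apply)
open Summit.QuantumFields.BalabanUV.Beta.FP.KernelPeriodisationFibTrace (tsum_sites_eq_sum_tsum)
open Summit.QuantumFields.BalabanUV.Beta.FP.PeriodisedBorderTables (apply_translate_of_blockCov₂)
open Summit.QuantumFields.BalabanUV.Beta.FP.TorusGaugeCovariance (nearBox mem_nearBox)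
open Summit.QuantumFields.BalabanUV.Beta.FP.TorusGaugeCovariancePairing (wrapPt wrapPt_coe wrapPt_of_mem)
open Summit.QuantumFields.BalabanUV.Beta.FP.TorusGaugeCovarianceCoarse (coarsePt coarsePt_coe)

variable {d : ℕ}

/-! ## §1 One step, CENTRED root: the (0.4)-symmetrised second-order insertion bi-jet along two bond weights -/

section OneStep

variable (M : Fin (d + 1) → ℕ) [∀ μ, NeZero (M μ)] (Lc : ℕ) [NeZero Lc]

omit [∀ μ, NeZero (M μ)] in
/-- [our object — bookkeeping] **THE (0.4)-SYMMETRISED ONE-STEP SECOND-ORDER INSERTION BI-JET ALONG TWO BOND WEIGHTS `w, w′`** of the symmetrised averaging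
`M ← fine Lc M` at the CENTRED root `ctr (d+1) Lc`: `Σ_b Σ_{b′} (w b · w′ b′) •` the PAIR-SYMMETRISED packed sym pair `½(symVh₂SAt ctr b b′_n + symVh₂SAt ctr b′_n b)` of
an1's (0.4)-symmetrised second-order border table, periodised in its second bond (`b′_n = b′ + T∘n`) and on the fine torus, read on ((coarse multiplier slots at
`coarsePt`, `inr`), (fine field slots, `inl`)) — `TorusCompositeCovarianceTwoPolar.stepIns₂₂` VERBATIM with `vh₂SAt (toSite r) ↦ symVh₂SAt (ctr (d+1) Lc)`; level-free,
no root parameter. -/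
def stepIns₂₂Sym (w w' : ↥(pbox (fine Lc M)) × Fin (d + 1) → ℝ) :
    Matrix (↥(pbox M) × Fin (d + 1)) (↥(pbox (fine Lc M)) × Fin (d + 1)) ℝ :=
  ∑ b : ↥(pbox (fine Lc M)) × Fin (d + 1), ∑ b' : ↥(pbox (fine Lc M)) × Fin (d + 1), (w b * w' b') •
    (perF (fine Lc M) (dper (fine Lc M) (fun x z a c => ∑' n : Site (d + 1), (1 / 2 : ℝ) *
        (symVh₂SAt (ctr (d + 1) Lc) Lc b.2 (b.1 : Site (d + 1)) b'.2 (translate (fine Lc M) (b'.1 : Site (d + 1)) n) x z a c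
          + symVh₂SAt (ctr (d + 1) Lc) Lc b'.2 (translate (fine Lc M) (b'.1 : Site (d + 1)) n) b.2 (b.1 : Site (d + 1)) x z a c)))).submatrix
      (fun a : ↥(pbox M) × Fin (d + 1) => ((coarsePt M Lc a.1, Sum.inr a.2) : Idx (fine Lc M) (Fib d)))
      (fun c : ↥(pbox (fine Lc M)) × Fin (d + 1) => ((c.1, Sum.inl c.2) : Idx (fine Lc M) (Fib d)))

omit [∀ μ, NeZero (M μ)] in
/-- [our object — bookkeeping] **THE (0.4)-SYMMETRISED ONE-STEP SECOND-ORDER INSERTION JET ALONG ONE BOND WEIGHT `w`** — the DIAGONAL `stepIns₂₂Sym M Lc w w` of the bi-jet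
(the sym twin of `TorusCompositeCovarianceTwoStep.stepIns₂`, whose body is `stepIns₂₂`'s at `w′ = w`; here defined AS the diagonal). -/
def stepIns₂Sym (w : ↥(pbox (fine Lc M)) × Fin (d + 1) → ℝ) :
    Matrix (↥(pbox M) × Fin (d + 1)) (↥(pbox (fine Lc M)) × Fin (d + 1)) ℝ :=
  stepIns₂₂Sym M Lc w w

omit [∀ μ, NeZero (M μ)] in
/-- [folklore] the diagonal of the sym bi-jet IS the sym second jet (`rfl`; twin of `stepIns₂₂_self`). -/
theorem stepIns₂₂Sym_self (w : ↥(pbox (fine Lc M)) × Fin (d + 1) → ℝ) : stepIns₂₂Sym M Lc w w = stepIns₂Sym M Lc w := rfl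

end OneStep

section Engines

variable (M : Fin (d + 1) → ℕ) [∀ μ, NeZero (M μ)]

/-- [folklore] (private copy of R-6 §1, verbatim — R-6 has no hub olean at the time of writing, so it cannot be imported by a file that is to verify now) **`sum_perZ_dper_mul_periodic_of_periodCov` — A PERIOD-COVARIANT INSERTION FAMILY ACTS ON PERIODIC FORMS COPY BY COPY.**  Letters: `hVP` joint
invariance of `V` under the period lattice in (bond, sites); `hS` finite support of the `(inr, inl)` entries in the fluctuation slot; `hT` finite support in the
family bond for a fixed multiplier site; `hB` periodicity of the form.  Conclusion:
`Σ_{y ∈ pbox M} Σ_l perZ M (dper M (V κ u)) x y (inr μ) (inl l) · B l y = Σ'_m Σ'_z Σ_l V κ (u + M∘m) x z (inr μ) (inl l) · B l z` (every sum finite). -/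
private theorem sum_perZ_dper_mul_periodic_of_periodCov (V : Fin (d + 1) → Site (d + 1) → MKer (d + 1) (Fib d)) (S T : Site (d + 1) → Finset (Site (d + 1)))
    (hVP : ∀ (κ : Fin (d + 1)) (u m x z : Site (d + 1)) (a c : Fib d), V κ (translate M u m) (translate M x m) (translate M z m) a c = V κ u x z a c)
    (hS : ∀ (κ : Fin (d + 1)) (u x : Site (d + 1)) (μ α : Fin (d + 1)), ∀ z ∉ S x, V κ u x z (Sum.inr μ) (Sum.inl α) = 0)
    (hT : ∀ (κ : Fin (d + 1)) (x z : Site (d + 1)) (μ α : Fin (d + 1)), ∀ u ∉ T x, V κ u x z (Sum.inr μ) (Sum.inl α) = 0)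
    (B : Form1 (d + 1) ℝ) (hB : ∀ (l : Fin (d + 1)) (y m : Site (d + 1)), B l (translate M y m) = B l y)
    (κ : Fin (d + 1)) (u x : Site (d + 1)) (μ : Fin (d + 1)) :
    ∑ y : ↥(pbox M), ∑ l : Fin (d + 1), perZ M (dper M (V κ u)) x (y : Site (d + 1)) (Sum.inr μ) (Sum.inl l) * B l (y : Site (d + 1))
      = ∑' m : Site (d + 1), ∑' z : Site (d + 1), ∑ l : Fin (d + 1), V κ (translate M u m) x z (Sum.inr μ) (Sum.inl l) * B l z := by
  -- the copies of the insertion bond that load the multiplier site `x` are finitely many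
  classical
  obtain ⟨F, hF⟩ : ∃ F : Finset (Site (d + 1)), ∀ m ∉ F, translate M u m ∉ T x :=
    ⟨(T x).preimage (fun m => translate M u m) (translate_injective (one_le_M M) u).injOn,
      fun m hm hh => hm (Finset.mem_preimage.2 hh)⟩
  -- one translated copy: `V κ u (x + M∘m) (z + M∘m) = V κ (u − M∘m) x z`
  have hcopy0 : ∀ (m z : Site (d + 1)) (a c : Fib d), V κ u (translate M x m) (translate M z m) a c = V κ (translate M u (-m)) x z a c := by
    intro m z a c
    have hu : translate M (translate M u (-m)) m = u := by
      rw [translate_translate, neg_add_cancel]; funext i; rw [translate_apply, Pi.zero_apply, mul_zero, add_zero]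
    rw [← hVP κ (translate M u (-m)) m x z a c, hu]
  have hdper : ∀ (z : Site (d + 1)) (l : Fin (d + 1)),
      dper M (V κ u) x z (Sum.inr μ) (Sum.inl l) = ∑ m ∈ F, V κ (translate M u m) x z (Sum.inr μ) (Sum.inl l) := fun z l => by
    have h0 : dper M (V κ u) x z (Sum.inr μ) (Sum.inl l) = ∑' m : Site (d + 1), V κ (translate M u m) x z (Sum.inr μ) (Sum.inl l) := by
      rw [dper_apply, ← (Equiv.neg (Site (d + 1))).tsum_eq fun m => V κ (translate M u m) x z (Sum.inr μ) (Sum.inl l)]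
      exact tsum_congr fun m => by rw [hcopy0, Equiv.neg_apply]
    rw [h0]
    exact tsum_eq_sum fun m hm => hT κ x z μ l _ (hF m hm)
  -- the periodised summand and its finite support in the fluctuation slot
  set H : Fin (d + 1) → Site (d + 1) → ℝ := fun l z => dper M (V κ u) x z (Sum.inr μ) (Sum.inl l) * B l z with hH
  have hHs : ∀ l, Summable (H l) := fun l =>
    summable_of_ne_finset_zero (s := S x) fun z hz => by
      simp only [hH]; rw [hdper, Finset.sum_eq_zero fun m _ => hS κ _ x μ l z hz, zero_mul]
  have hterm : ∀ (y : ↥(pbox M)) (l : Fin (d + 1)),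
      perZ M (dper M (V κ u)) x (y : Site (d + 1)) (Sum.inr μ) (Sum.inl l) * B l (y : Site (d + 1))
        = ∑' m : Site (d + 1), H l (translate M (y : Site (d + 1)) m) := fun y l => by
    rw [perZ_apply, ← tsum_mul_right]
    refine tsum_congr fun m => ?_
    simp only [hH]
    rw [hB]
  have hsm : ∀ m ∈ F, Summable fun z : Site (d + 1) => ∑ l : Fin (d + 1), V κ (translate M u m) x z (Sum.inr μ) (Sum.inl l) * B l z := fun m _ =>
    summable_of_ne_finset_zero (s := S x) fun z hz => Finset.sum_eq_zero fun l _ => by rw [hS κ _ x μ l z hz, zero_mul]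
  calc ∑ y : ↥(pbox M), ∑ l : Fin (d + 1), perZ M (dper M (V κ u)) x (y : Site (d + 1)) (Sum.inr μ) (Sum.inl l) * B l (y : Site (d + 1))
      = ∑ y : ↥(pbox M), ∑ l : Fin (d + 1), ∑' m : Site (d + 1), H l (translate M (y : Site (d + 1)) m) :=
        Finset.sum_congr rfl fun y _ => Finset.sum_congr rfl fun l _ => hterm y l
    _ = ∑ l : Fin (d + 1), ∑ y : ↥(pbox M), ∑' m : Site (d + 1), H l (translate M (y : Site (d + 1)) m) := Finset.sum_comm
    _ = ∑ l : Fin (d + 1), ∑' z : Site (d + 1), H l z := Finset.sum_congr rfl fun l _ => (tsum_sites_eq_sum_tsum M (hHs l)).symm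
    _ = ∑' z : Site (d + 1), ∑ l : Fin (d + 1), H l z := (Summable.tsum_finsetSum fun l _ => hHs l).symm
    _ = ∑' z : Site (d + 1), ∑ m ∈ F, ∑ l : Fin (d + 1), V κ (translate M u m) x z (Sum.inr μ) (Sum.inl l) * B l z := by
        refine tsum_congr fun z => ?_
        rw [Finset.sum_comm]
        exact Finset.sum_congr rfl fun l _ => by simp only [hH]; rw [hdper z l, Finset.sum_mul]
    _ = ∑ m ∈ F, ∑' z : Site (d + 1), ∑ l : Fin (d + 1), V κ (translate M u m) x z (Sum.inr μ) (Sum.inl l) * B l z := Summable.tsum_finsetSum hsm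
    _ = ∑' m : Site (d + 1), ∑' z : Site (d + 1), ∑ l : Fin (d + 1), V κ (translate M u m) x z (Sum.inr μ) (Sum.inl l) * B l z := by
        refine (tsum_eq_sum fun m hm => ?_).symm
        exact (tsum_congr fun z => Finset.sum_eq_zero fun l _ => by rw [hT κ x z μ l _ (hF m hm), zero_mul]).trans tsum_zero

end Engines

/-! ## §3 Entries and support of an1's packed (0.4)-symmetrised second-order table at the centred root -/

section Entries

variable (Lc : ℕ)

/-- [folklore] The `(inr μ, inl α)` entry of an1's packed (0.4)-symmetrised second-order table (any root `ρ`): the sym kernel `s_sym((α,z); (κ,u), (κ′,u′))` on the root sites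
(twin of g25's `vh₂SAt_inr_inl_eq`; `packVH_inr_inl`). -/
theorem symVh₂SAt_inr_inl_eq (ρ : Site (d + 1)) (L : ℕ) (κ : Fin (d + 1)) (u : Site (d + 1)) (κ' : Fin (d + 1)) (u' x z : Site (d + 1)) (μ α : Fin (d + 1)) :
    symVh₂SAt ρ L κ u κ' u' x z (Sum.inr μ) (Sum.inl α) = if off L x = 0 then symVh2KerAt ρ L μ (blk L x) (α, z) (κ, u) (κ', u') else 0 := by
  simp only [symVh₂SAt, packVH_inr_inl]

/-- [folklore] at the CENTRED root `ctr (d+1) Lc = toSite (ctrOff (d+1) Lc)` (`rfl`) an1's real (0.4)-symmetrised second-order kernel vanishes when ANY of its three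
bonds is based off the support box of the block (an1's `symVh2Tab_eq_zero₁∕₂∕₃`; twin of g25's `vh2KerAt_eq_zero_of_not_near`). -/
theorem symVh2KerAt_ctr_eq_zero_of_not_near (hc : ctrOff (d + 1) Lc ∈ box (d + 1) Lc) (μ : Fin (d + 1)) (y : Site (d + 1)) {f g g' : Bond (d + 1)}
    (h : ¬ Near Lc y f.2 ∨ ¬ Near Lc y g.2 ∨ ¬ Near Lc y g'.2) : symVh2KerAt (ctr (d + 1) Lc) Lc μ y f g g' = 0 := by
  show ((symVh2Tab (toSite (ctrOff (d + 1) Lc)) Lc μ y f g g' : ℚ) : ℝ) = 0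
  rcases h with h | h | h
  · rw [symVh2Tab_eq_zero₁ hc μ y h g g', Rat.cast_zero]
  · rw [symVh2Tab_eq_zero₂ hc μ y f h g', Rat.cast_zero]
  · rw [symVh2Tab_eq_zero₃ hc μ y f g h, Rat.cast_zero]

/-- [folklore] support of the `(inr, inl)` entries of the PAIR-SYMMETRISED SYM PAIR at the centred root: off the window of the block of `x` in the fluctuation site `z`,
or in either bond base `u`, `u′`, the entry vanishes (twin of g25's `pair_inr_inl_eq_zero_of_not_mem`). -/
theorem symPair_inr_inl_eq_zero_of_not_mem (hc : ctrOff (d + 1) Lc ∈ box (d + 1) Lc) (κ : Fin (d + 1)) (u : Site (d + 1)) (κ' : Fin (d + 1))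
    (u' x z : Site (d + 1)) (μ α : Fin (d + 1)) (h : z ∉ nearBox Lc (blk Lc x) ∨ u ∉ nearBox Lc (blk Lc x) ∨ u' ∉ nearBox Lc (blk Lc x)) :
    (1 / 2 : ℝ) * (symVh₂SAt (ctr (d + 1) Lc) Lc κ u κ' u' x z (Sum.inr μ) (Sum.inl α)
      + symVh₂SAt (ctr (d + 1) Lc) Lc κ' u' κ u x z (Sum.inr μ) (Sum.inl α)) = 0 := by
  rw [mem_nearBox, mem_nearBox, mem_nearBox] at h
  rw [symVh₂SAt_inr_inl_eq, symVh₂SAt_inr_inl_eq]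
  by_cases hx : off Lc x = 0
  · rw [if_pos hx, if_pos hx]
    rcases h with h | h | h
    · rw [symVh2KerAt_ctr_eq_zero_of_not_near Lc hc μ _ (f := (α, z)) (Or.inl h),
        symVh2KerAt_ctr_eq_zero_of_not_near Lc hc μ _ (f := (α, z)) (Or.inl h)]; ring
    · rw [symVh2KerAt_ctr_eq_zero_of_not_near Lc hc μ _ (g := (κ, u)) (Or.inr (Or.inl h)),
        symVh2KerAt_ctr_eq_zero_of_not_near Lc hc μ _ (g' := (κ, u)) (Or.inr (Or.inr h))]; ring
    · rw [symVh2KerAt_ctr_eq_zero_of_not_near Lc hc μ _ (g' := (κ', u')) (Or.inr (Or.inr h)),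
        symVh2KerAt_ctr_eq_zero_of_not_near Lc hc μ _ (g := (κ', u')) (Or.inr (Or.inl h))]; ring
  · rw [if_neg hx, if_neg hx]; ring

end Entries

section Pair

variable (M : Fin (d + 1) → ℕ) [∀ μ, NeZero (M μ)] (Lc : ℕ) [NeZero Lc]

/-- [folklore] **AT A COARSE MULTIPLIER SITE THE `(inr, inl)` ENTRY OF an1's PACKED (0.4)-SYMMETRISED SECOND-ORDER TABLE IS an1's SYMMETRISED KERNEL** (any root `ρ`):
`symVh₂SAt ρ Lc κ u κ′ u′ (Lc•x) z (inr κ₀) (inl l) = symVh2KerAt ρ Lc κ₀ x (l, z) (κ, u) (κ′, u′)` (`symVh₂SAt_inr_inl_eq` at `off Lc (Lc•x) = 0`, `blk Lc (Lc•x) = x`; twin of R-6's `vh₂SAt_zsmul_inr_inl`). -/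
theorem symVh₂SAt_zsmul_inr_inl (ρ : Site (d + 1)) (κ : Fin (d + 1)) (u : Site (d + 1)) (κ' : Fin (d + 1)) (u' x z : Site (d + 1)) (κ₀ l : Fin (d + 1)) :
    symVh₂SAt ρ Lc κ u κ' u' ((Lc : ℤ) • x) z (Sum.inr κ₀) (Sum.inl l) = symVh2KerAt ρ Lc κ₀ x (l, z) (κ, u) (κ', u') := by
  rw [symVh₂SAt_inr_inl_eq, if_pos ((off_eq_zero_iff_proj _).2 (proj_zsmul (N := Lc) x)), blk_eq_quo, quo_zsmul (N := Lc)]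

omit [∀ μ, NeZero (M μ)] in
/-- [folklore] … hence the second-bond-periodised (0.4)-symmetrised pair at a coarse multiplier site is the copy sum of the pair-symmetrised sym kernel (twin of R-6's `pair_zsmul_inr_inl`). -/
theorem symPair_zsmul_inr_inl (ρ : Site (d + 1)) (κ : Fin (d + 1)) (u : Site (d + 1)) (κ' : Fin (d + 1)) (u' x z : Site (d + 1)) (κ₀ l : Fin (d + 1)) :
    (∑' n : Site (d + 1), (1 / 2 : ℝ) * (symVh₂SAt ρ Lc κ u κ' (translate (fine Lc M) u' n) ((Lc : ℤ) • x) z (Sum.inr κ₀) (Sum.inl l)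
        + symVh₂SAt ρ Lc κ' (translate (fine Lc M) u' n) κ u ((Lc : ℤ) • x) z (Sum.inr κ₀) (Sum.inl l)))
      = ∑' n : Site (d + 1), (1 / 2 : ℝ) * (symVh2KerAt ρ Lc κ₀ x (l, z) (κ, u) (κ', translate (fine Lc M) u' n)
          + symVh2KerAt ρ Lc κ₀ x (l, z) (κ', translate (fine Lc M) u' n) (κ, u)) :=
  tsum_congr fun n => by rw [symVh₂SAt_zsmul_inr_inl, symVh₂SAt_zsmul_inr_inl]

omit [NeZero Lc] in
/-- [folklore] the pair-symmetrised sym kernel vanishes when any of its three bonds is based off an1's box `Near Lc x` (§3 `symVh2KerAt_ctr_eq_zero_of_not_near`). -/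
theorem symm_symVh2KerAt_eq_zero_of_not_mem (hc : ctrOff (d + 1) Lc ∈ box (d + 1) Lc) (κ₀ : Fin (d + 1)) (x : Site (d + 1)) {f g g' : Bond (d + 1)}
    (h : f.2 ∉ nearBox Lc x ∨ g.2 ∉ nearBox Lc x ∨ g'.2 ∉ nearBox Lc x) :
    (1 / 2 : ℝ) * (symVh2KerAt (ctr (d + 1) Lc) Lc κ₀ x f g g' + symVh2KerAt (ctr (d + 1) Lc) Lc κ₀ x f g' g) = 0 := by
  rw [mem_nearBox, mem_nearBox, mem_nearBox] at h
  rcases h with h | h | h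
  · rw [symVh2KerAt_ctr_eq_zero_of_not_near Lc hc κ₀ x (Or.inl h), symVh2KerAt_ctr_eq_zero_of_not_near Lc hc κ₀ x (Or.inl h)]; ring
  · rw [symVh2KerAt_ctr_eq_zero_of_not_near Lc hc κ₀ x (Or.inr (Or.inl h)), symVh2KerAt_ctr_eq_zero_of_not_near Lc hc κ₀ x (Or.inr (Or.inr h))]; ring
  · rw [symVh2KerAt_ctr_eq_zero_of_not_near Lc hc κ₀ x (Or.inr (Or.inr h)), symVh2KerAt_ctr_eq_zero_of_not_near Lc hc κ₀ x (Or.inr (Or.inl h))]; ring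

omit [NeZero Lc] in
/-- [folklore] the lattice pairing of the pair-symmetrised sym kernel with any form vanishes when either background bond is based off an1's box. -/
theorem tsum_symm_symVh2KerAt_mul_eq_zero_of_not_mem (hc : ctrOff (d + 1) Lc ∈ box (d + 1) Lc) (κ₀ : Fin (d + 1)) (x : Site (d + 1)) {g g' : Bond (d + 1)}
    (h : g.2 ∉ nearBox Lc x ∨ g'.2 ∉ nearBox Lc x) (B : Form1 (d + 1) ℝ) :
    ∑' z : Site (d + 1), ∑ l : Fin (d + 1), (1 / 2 : ℝ) * (symVh2KerAt (ctr (d + 1) Lc) Lc κ₀ x (l, z) g g' + symVh2KerAt (ctr (d + 1) Lc) Lc κ₀ x (l, z) g' g) * B l z = 0 := by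
  refine (tsum_congr fun z => ?_).trans tsum_zero
  exact Finset.sum_eq_zero fun l _ => by rw [symm_symVh2KerAt_eq_zero_of_not_mem Lc hc κ₀ x (Or.inr h), zero_mul]

omit [NeZero Lc] in
/-- [folklore] the pair-symmetrised sym kernel against a form is summable in the fluctuation site (finite support `Near Lc x`). -/
theorem summable_sum_symm_symVh2KerAt_mul (hc : ctrOff (d + 1) Lc ∈ box (d + 1) Lc) (κ₀ : Fin (d + 1)) (x : Site (d + 1)) (g g' : Bond (d + 1)) (B : Form1 (d + 1) ℝ) :
    Summable fun z : Site (d + 1) => ∑ l : Fin (d + 1), (1 / 2 : ℝ) * (symVh2KerAt (ctr (d + 1) Lc) Lc κ₀ x (l, z) g g' + symVh2KerAt (ctr (d + 1) Lc) Lc κ₀ x (l, z) g' g) * B l z :=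
  summable_of_ne_finset_zero (s := nearBox Lc x) fun z hz =>
    Finset.sum_eq_zero fun l _ => by rw [symm_symVh2KerAt_eq_zero_of_not_mem Lc hc κ₀ x (f := (l, z)) (Or.inl hz), zero_mul]

omit [∀ μ, NeZero (M μ)] in
/-- [folklore] **JOINT INVARIANCE UNDER THE PERIOD LATTICE** of the second-bond-periodised pair-symmetrised sym pair
`V κ u := Σ'_n ½(S₂^{sym} κ u κ′ (u′+T∘n) + S₂^{sym} κ′ (u′+T∘n) κ u)` (`T = fine Lc M`): `V κ (u + T∘m) (x + T∘m) (z + T∘m) = V κ u x z` — an1's block covariance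
`symVh₂SAt_translate` per copy (`apply_translate_of_blockCov₂`), re-indexing `n ↦ n + m` (twin of g25's `borderT2_periodCov`). -/
theorem symBorderT2_periodCov (κ' : Fin (d + 1)) (u' : Site (d + 1)) {V : Fin (d + 1) → Site (d + 1) → MKer (d + 1) (Fib d)}
    (hV : V = fun κ u x z a c => ∑' n : Site (d + 1), (1 / 2 : ℝ) * (symVh₂SAt (ctr (d + 1) Lc) Lc κ u κ' (translate (fine Lc M) u' n) x z a c
      + symVh₂SAt (ctr (d + 1) Lc) Lc κ' (translate (fine Lc M) u' n) κ u x z a c))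
    (κ : Fin (d + 1)) (u m x z : Site (d + 1)) (a c : Fib d) :
    V κ (translate (fine Lc M) u m) (translate (fine Lc M) x m) (translate (fine Lc M) z m) a c = V κ u x z a c := by
  have hL : 1 ≤ Lc := Nat.one_le_iff_ne_zero.mpr (NeZero.ne Lc)
  have hM : ∀ i, fine Lc M i = Lc * M i := fun i => rfl
  subst hV
  -- the two-bond pair as ONE block-covariant family `W κ u κ′ u′`
  have hWt : ∀ (κ : Fin (d + 1)) (u : Site (d + 1)) (κ' : Fin (d + 1)) (u' t : Site (d + 1)),
      (fun x z a c => (1 / 2 : ℝ) * (symVh₂SAt (ctr (d + 1) Lc) Lc κ (u + (Lc : ℤ) • t) κ' (u' + (Lc : ℤ) • t) x z a c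
          + symVh₂SAt (ctr (d + 1) Lc) Lc κ' (u' + (Lc : ℤ) • t) κ (u + (Lc : ℤ) • t) x z a c))
        = shiftK (-((Lc : ℤ) • t)) (fun x z a c => (1 / 2 : ℝ) * (symVh₂SAt (ctr (d + 1) Lc) Lc κ u κ' u' x z a c
          + symVh₂SAt (ctr (d + 1) Lc) Lc κ' u' κ u x z a c)) := by
    intro κ u κ' u' t
    funext x z a c
    rw [symVh₂SAt_translate hL, symVh₂SAt_translate hL]
    rfl
  show (∑' n : Site (d + 1), (1 / 2 : ℝ) * (symVh₂SAt (ctr (d + 1) Lc) Lc κ (translate (fine Lc M) u m) κ' (translate (fine Lc M) u' n)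
          (translate (fine Lc M) x m) (translate (fine Lc M) z m) a c
        + symVh₂SAt (ctr (d + 1) Lc) Lc κ' (translate (fine Lc M) u' n) κ (translate (fine Lc M) u m) (translate (fine Lc M) x m) (translate (fine Lc M) z m) a c))
      = ∑' n : Site (d + 1), (1 / 2 : ℝ) * (symVh₂SAt (ctr (d + 1) Lc) Lc κ u κ' (translate (fine Lc M) u' n) x z a c
        + symVh₂SAt (ctr (d + 1) Lc) Lc κ' (translate (fine Lc M) u' n) κ u x z a c)
  rw [← (Equiv.addRight m).tsum_eq (fun n => (1 / 2 : ℝ) * (symVh₂SAt (ctr (d + 1) Lc) Lc κ (translate (fine Lc M) u m) κ' (translate (fine Lc M) u' n)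
          (translate (fine Lc M) x m) (translate (fine Lc M) z m) a c
        + symVh₂SAt (ctr (d + 1) Lc) Lc κ' (translate (fine Lc M) u' n) κ (translate (fine Lc M) u m) (translate (fine Lc M) x m) (translate (fine Lc M) z m) a c))]
  refine tsum_congr fun n => ?_
  have key := apply_translate_of_blockCov₂ hM
    (W := fun κ u κ' u' => fun x z a c => (1 / 2 : ℝ) * (symVh₂SAt (ctr (d + 1) Lc) Lc κ u κ' u' x z a c + symVh₂SAt (ctr (d + 1) Lc) Lc κ' u' κ u x z a c))
    hWt κ (translate (fine Lc M) u m) κ' (translate (fine Lc M) u' (n + m)) m x z a c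
  rw [Equiv.coe_addRight]
  rw [translate_translate, translate_translate, add_neg_cancel, add_neg_cancel_right] at key
  have e0 : translate (fine Lc M) u (0 : Site (d + 1)) = u := by funext i; rw [translate_apply, Pi.zero_apply, mul_zero, add_zero]
  rw [e0] at key
  exact key

omit [∀ μ, NeZero (M μ)] [NeZero Lc] in
/-- [folklore] window letter `hT` (first bond = family index): on the `(inr, inl)` block `V κ u x z` vanishes unless `u ∈ nearBox Lc (blk Lc x)`
(twin of g25's `borderT2_inr_inl_eq_zero_of_not_mem_T`). -/
theorem symBorderT2_inr_inl_eq_zero_of_not_mem_T (hc : ctrOff (d + 1) Lc ∈ box (d + 1) Lc) (κ' : Fin (d + 1)) (u' : Site (d + 1))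
    {V : Fin (d + 1) → Site (d + 1) → MKer (d + 1) (Fib d)}
    (hV : V = fun κ u x z a c => ∑' n : Site (d + 1), (1 / 2 : ℝ) * (symVh₂SAt (ctr (d + 1) Lc) Lc κ u κ' (translate (fine Lc M) u' n) x z a c
      + symVh₂SAt (ctr (d + 1) Lc) Lc κ' (translate (fine Lc M) u' n) κ u x z a c))
    (κ : Fin (d + 1)) (x z : Site (d + 1)) (μ α : Fin (d + 1)) : ∀ u ∉ nearBox Lc (blk Lc x), V κ u x z (Sum.inr μ) (Sum.inl α) = 0 := fun u hu => by
  subst hV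
  exact (tsum_congr fun n => symPair_inr_inl_eq_zero_of_not_mem Lc hc κ u κ' _ x z μ α (Or.inr (Or.inl hu))).trans tsum_zero

omit [∀ μ, NeZero (M μ)] [NeZero Lc] in
/-- [folklore] window letter `hS` (fluctuation leg): on the `(inr, inl)` block `V κ u x z` vanishes unless `z ∈ nearBox Lc (blk Lc x)`
(twin of g25's `borderT2_inr_inl_eq_zero_of_not_mem_S`). -/
theorem symBorderT2_inr_inl_eq_zero_of_not_mem_S (hc : ctrOff (d + 1) Lc ∈ box (d + 1) Lc) (κ' : Fin (d + 1)) (u' : Site (d + 1))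
    {V : Fin (d + 1) → Site (d + 1) → MKer (d + 1) (Fib d)}
    (hV : V = fun κ u x z a c => ∑' n : Site (d + 1), (1 / 2 : ℝ) * (symVh₂SAt (ctr (d + 1) Lc) Lc κ u κ' (translate (fine Lc M) u' n) x z a c
      + symVh₂SAt (ctr (d + 1) Lc) Lc κ' (translate (fine Lc M) u' n) κ u x z a c))
    (κ : Fin (d + 1)) (u x : Site (d + 1)) (μ α : Fin (d + 1)) : ∀ z ∉ nearBox Lc (blk Lc x), V κ u x z (Sum.inr μ) (Sum.inl α) = 0 := fun z hz => by
  subst hV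
  exact (tsum_congr fun n => symPair_inr_inl_eq_zero_of_not_mem Lc hc κ u κ' _ x z μ α (Or.inl hz)).trans tsum_zero

/-- [folklore] **`sum_perF_dper_symPair_mul_periodic` — THE TORUS INSERTION OF THE SECOND-BOND-PERIODISED (0.4)-SYMMETRISED PAIR AT ONE PAIR OF TORUS BONDS ACTS ON
PERIODIC FORMS AS an1's (0.4)-SYMMETRISED SECOND-ORDER KERNEL, COPY BY COPY IN BOTH BONDS** (centred root, `ctrOff ∈ box`; `B` `fine Lc M`-periodic; `x ∈ pbox M`, `κ₀`) —
the twin of R-6's `sum_perF_dper_pair_mul_periodic` (§2's engine with §4's letters `symBorderT2_periodCov ∕ symBorderT2_inr_inl_eq_zero_of_not_mem_S ∕ _T`). -/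
theorem sum_perF_dper_symPair_mul_periodic (hc : ctrOff (d + 1) Lc ∈ box (d + 1) Lc) (κ : Fin (d + 1)) (u : Site (d + 1)) (κ' : Fin (d + 1)) (u' : Site (d + 1))
    (B : Form1 (d + 1) ℝ) (hB : ∀ (l : Fin (d + 1)) (y m : Site (d + 1)), B l (translate (fine Lc M) y m) = B l y) (x : ↥(pbox M)) (κ₀ : Fin (d + 1)) :
    ∑ y : ↥(pbox (fine Lc M)), ∑ l : Fin (d + 1),
        perF (fine Lc M) (dper (fine Lc M) (fun x z a c => ∑' n : Site (d + 1), (1 / 2 : ℝ) *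
          (symVh₂SAt (ctr (d + 1) Lc) Lc κ u κ' (translate (fine Lc M) u' n) x z a c + symVh₂SAt (ctr (d + 1) Lc) Lc κ' (translate (fine Lc M) u' n) κ u x z a c)))
          (coarsePt M Lc x, Sum.inr κ₀) (y, Sum.inl l) * B l (y : Site (d + 1))
      = ∑' m : Site (d + 1), ∑' n : Site (d + 1), ∑' z : Site (d + 1), ∑ l : Fin (d + 1),
          (1 / 2 : ℝ) * (symVh2KerAt (ctr (d + 1) Lc) Lc κ₀ (x : Site (d + 1)) (l, z) (κ, translate (fine Lc M) u m) (κ', translate (fine Lc M) u' n)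
            + symVh2KerAt (ctr (d + 1) Lc) Lc κ₀ (x : Site (d + 1)) (l, z) (κ', translate (fine Lc M) u' n) (κ, translate (fine Lc M) u m)) * B l z := by
  -- the engine, at the pair family `V κ u` of the second torus bond `(κ′, u′)`
  have step := sum_perZ_dper_mul_periodic_of_periodCov (fine Lc M)
    (fun κ u x z a c => ∑' n : Site (d + 1), (1 / 2 : ℝ) *
      (symVh₂SAt (ctr (d + 1) Lc) Lc κ u κ' (translate (fine Lc M) u' n) x z a c + symVh₂SAt (ctr (d + 1) Lc) Lc κ' (translate (fine Lc M) u' n) κ u x z a c))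
    (fun x => nearBox Lc (blk Lc x)) (fun x => nearBox Lc (blk Lc x)) (symBorderT2_periodCov M Lc κ' u' rfl)
    (fun κ u x μ α => symBorderT2_inr_inl_eq_zero_of_not_mem_S M Lc hc κ' u' rfl κ u x μ α)
    (fun κ x z μ α => symBorderT2_inr_inl_eq_zero_of_not_mem_T M Lc hc κ' u' rfl κ x z μ α) B hB κ u
    ((coarsePt M Lc x : ↥(pbox (fine Lc M))) : Site (d + 1)) κ₀
  simp only [perF_apply]
  rw [step]
  refine tsum_congr fun m => ?_
  -- the pair-symmetrised sym kernel along the copies of the second bond (first bond at its `m`-th copy)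
  set K : Site (d + 1) → Site (d + 1) → Fin (d + 1) → ℝ := fun n z l => (1 / 2 : ℝ) *
    (symVh2KerAt (ctr (d + 1) Lc) Lc κ₀ (x : Site (d + 1)) (l, z) (κ, translate (fine Lc M) u m) (κ', translate (fine Lc M) u' n)
      + symVh2KerAt (ctr (d + 1) Lc) Lc κ₀ (x : Site (d + 1)) (l, z) (κ', translate (fine Lc M) u' n) (κ, translate (fine Lc M) u m)) with hK
  -- at the coarse multiplier site the pair entry is the copy sum of the pair-symmetrised sym kernel
  have hentry : ∀ (z : Site (d + 1)) (l : Fin (d + 1)),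
      (fun x z a c => ∑' n : Site (d + 1), (1 / 2 : ℝ) *
        (symVh₂SAt (ctr (d + 1) Lc) Lc κ (translate (fine Lc M) u m) κ' (translate (fine Lc M) u' n) x z a c
          + symVh₂SAt (ctr (d + 1) Lc) Lc κ' (translate (fine Lc M) u' n) κ (translate (fine Lc M) u m) x z a c))
        ((coarsePt M Lc x : ↥(pbox (fine Lc M))) : Site (d + 1)) z (Sum.inr κ₀) (Sum.inl l) = ∑' n : Site (d + 1), K n z l := fun z l => by
    simp only [hK, coarsePt_coe]
    exact symPair_zsmul_inr_inl M Lc (ctr (d + 1) Lc) κ _ κ' u' _ z κ₀ l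
  -- the copies of the second bond loading the block of `x` are finitely many; swap the finite copy sum out
  classical
  obtain ⟨Fn, hFn⟩ : ∃ F : Finset (Site (d + 1)), ∀ m ∉ F, translate (fine Lc M) u' m ∉ nearBox Lc (x : Site (d + 1)) :=
    ⟨(nearBox Lc (x : Site (d + 1))).preimage (fun m => translate (fine Lc M) u' m) (translate_injective (one_le_M (fine Lc M)) u').injOn,
      fun m hm hh => hm (Finset.mem_preimage.2 hh)⟩
  have hK0 : ∀ n ∉ Fn, ∀ (z : Site (d + 1)) (l : Fin (d + 1)), K n z l = 0 := fun n hn z l =>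
    symm_symVh2KerAt_eq_zero_of_not_mem Lc hc κ₀ _ (g' := (κ', translate (fine Lc M) u' n)) (Or.inr (Or.inr (hFn n hn)))
  have hfin : ∀ (z : Site (d + 1)) (l : Fin (d + 1)), ∑' n : Site (d + 1), K n z l = ∑ n ∈ Fn, K n z l := fun z l =>
    tsum_eq_sum fun n hn => hK0 n hn z l
  calc ∑' z : Site (d + 1), ∑ l : Fin (d + 1),
        (fun x z a c => ∑' n : Site (d + 1), (1 / 2 : ℝ) *
          (symVh₂SAt (ctr (d + 1) Lc) Lc κ (translate (fine Lc M) u m) κ' (translate (fine Lc M) u' n) x z a c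
            + symVh₂SAt (ctr (d + 1) Lc) Lc κ' (translate (fine Lc M) u' n) κ (translate (fine Lc M) u m) x z a c))
          ((coarsePt M Lc x : ↥(pbox (fine Lc M))) : Site (d + 1)) z (Sum.inr κ₀) (Sum.inl l) * B l z
      = ∑' z : Site (d + 1), ∑ n ∈ Fn, ∑ l : Fin (d + 1), K n z l * B l z := by
        refine tsum_congr fun z => ?_
        rw [Finset.sum_comm]
        exact Finset.sum_congr rfl fun l _ => by rw [hentry z l, hfin z l, Finset.sum_mul]
    _ = ∑ n ∈ Fn, ∑' z : Site (d + 1), ∑ l : Fin (d + 1), K n z l * B l z :=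
        Summable.tsum_finsetSum fun n _ => summable_sum_symm_symVh2KerAt_mul Lc hc κ₀ _ _ _ B
    _ = ∑' n : Site (d + 1), ∑' z : Site (d + 1), ∑ l : Fin (d + 1), K n z l * B l z :=
        (tsum_eq_sum fun n hn => (tsum_congr fun z => Finset.sum_eq_zero fun l _ => by rw [hK0 n hn z l, zero_mul]).trans tsum_zero).symm

end Pair

end Summit.QuantumFields.BalabanUV.Beta.FP.TorusStepInsertionSymTwo

end
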